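import Summits.BirchSwinnertonDyer.BirchSwinnertonDyer.Theorems.ManinLocalTwoThreeTwistOrbitMinimalResidualSynthesis
import Summits.BirchSwinnertonDyer.BirchSwinnertonDyer.Theorems.ManinLocalTwoThreeManinOddAtFourKatoShiftLever

/-!
# Route `ManinLocalTwoThree`, crux C2 `ManinOddAtFour` (stmt-BirchSwinnertonDyer-22967): RESIDUAL SYNTHESIS, GENERIC AND ON
# THE TWIST-ORBIT-MINIMAL CLASSES — the multi-shift certificate need only hold, and the two residuals need only be supplied,
# on whatever class predicate the untwisting reductions reach (line prover p1, lead integration step; helper)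

Sequel to `…ManinOddAtFourResidualSynthesis` (p589044, globally twist-minimal classes). Two things:
* GENERIC SPLIT `maninOddAtFour_of_reduction_of_split`: for ANY predicate `P W N` such that C2 follows from Manin at `2`
  on the lattice-optimal data with `4 ∣ N` and `P W N` (a landed REDUCTION, hypothesis `hred`), C2 follows from (the
  multi-shift certificate `4 ∤ c ∧ (Δ_W < 0 → 2 ∤ c)` on the `W[2]`-irreducible data with `P`) ∧ (the archimedean
  residual `Δ_W > 0`: `4 ∤ c ⟹ 2 ∤ c` on the irreducible data with `P`) ∧ (Manin at `2` on the `W[2]`-reducible data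
  with `P`); corollaries `…_of_reduction_of_katoShift` (certificate := the leaf `KatoShiftTwistManinTwo`, E-es-21) and
  `…_of_reduction_of_katoFact_of_generation` (certificate := F-es-21 ∧ E-es-22 through the landed lever
  `katoShiftTwistManinTwo_of_katoFact_of_generation`). Future sharper reductions plug in with no new proof.
* INSTANCE `P :=` TWIST-ORBIT-MINIMAL (seat p2 gen 2, `maninLocalTwoThree_maninOddAtFour_of_twistOrbitMinimal`, p591187:
  no (i) dyadic-semistable, (ii) odd-semistable, (iii) `χ₋₄` additive lower-level, (iv) aligned `χ±8`, (v) aligned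
  same-level `χ_{q*}` untwist; residue 259 325 of the 897 670 optimal classes with `4 ∣ N < 5·10⁵`):
  the certificate-level forms are seat p2's `maninLocalTwoThree_maninOddAtFour_of_orbitMinimalKatoShift_of_orbitMinimalResiduals`
  / `…_of_katoShift_of_orbitMinimalResiduals` (`…TwistOrbitMinimalResidualSynthesis`, landed first); this file adds the
  fact-level form `maninOddAtFour_of_katoFact_of_generation_of_orbitMinimalResiduals` (F-es-21 ∧ E-es-22 ∧ orbit-minimal
  residuals, through the lead's lever p591888) — the composition of the lead's v4 skeleton
  `Cruxes/ManinOddAtFour/Lines/kato_shift_two.lean`.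
`W[2]` and the sign of `Δ` are twist-invariant, so restricting the residual leaves E-es-23 (a)/(b) to the orbit-minimal
classes loses nothing. HONEST FRAMING: `proof.conditional` reductions; F-es-21 is a statement-only fact, E-es-22 a
conjecture, the residuals open. Manin's conjecture at `2` is NOT proved here; nothing about BSD is proved here.
-/

set_option autoImplicit false
set_option linter.dupNamespace false

noncomputable section

open scoped Classical MatrixGroups ModularForm

open CongruenceSubgroup WeierstrassCurve Literature.NumberTheory.EllipticCurves
  Literature.NumberTheory.EllipticCurves.ModularForms
  Summit.BirchSwinnertonDyer.Rank1Residual.ManinAdditive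

namespace Summit.BirchSwinnertonDyer.BirchSwinnertonDyer.Theorems.ManinLocalTwoThree

section Generic

variable (P : WeierstrassCurve ℚ → ℕ → Prop)

/-- **Generic split of C2 along a reduction.** If C2 follows from Manin at `2` on the lattice-optimal data with
`4 ∣ N` in a class predicate `P` (`hred`, a landed untwisting reduction), then C2 follows from the multi-shift
certificate on the `W[2]`-irreducible such data, the archimedean residual (`Δ_W > 0`: `4 ∤ c ⟹ 2 ∤ c`) on the
irreducible such data, and Manin at `2` on the `W[2]`-reducible such data (`Δ_W = 0` is impossible: `W.isUnit_Δ`).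
[cite: Kato2004Asterisque, Thm. 9.7 (p. 189)] [cite: Stevens1989, Lemmas (5.2), (5.4)] -/
theorem maninOddAtFour_of_reduction_of_split
    (hred : (Literature.NumberTheory.EllipticCurves.ModularForms.mazur_not_dvd_maninConstant_of_odd →
      Literature.NumberTheory.EllipticCurves.ModularForms.abbesUllmo_not_dvd_maninConstant_of_not_dvd_level →
      Literature.NumberTheory.EllipticCurves.ModularForms.cesnavicius_not_two_dvd_maninConstant_of_two_dvd_level →
      Literature.NumberTheory.EllipticCurves.ModularForms.exists_isNewformOf →
      ∀ (W : WeierstrassCurve ℚ) [W.IsElliptic] [W.IsGloballyMinimal] {N : ℕ} [NeZero N]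
        (D : ModularParametrizationData W N),
        (∀ z ∈ D.L.lattice, ∃ w ∈ periodLattice D.f, z = D.c * w) → 2 ^ 2 ∣ N → P W N →
        ¬ (2 : ℤ) ∣ D.maninConstant) →
      Summit.BirchSwinnertonDyer.BirchSwinnertonDyer.Theses.ManinLocalTwoThree.ManinOddAtFour)
    (hA : ∀ (W : WeierstrassCurve ℚ) [W.IsElliptic] [W.IsGloballyMinimal] {N : ℕ} [NeZero N]
      (D : ModularParametrizationData W N),
      (∀ z ∈ D.L.lattice, ∃ w ∈ periodLattice D.f, z = D.c * w) → 2 ^ 2 ∣ N →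
      P W N → W.HasIrreducibleModPGaloisRep 2 → ¬ (4 : ℤ) ∣ D.c ∧ (W.Δ < 0 → ¬ (2 : ℤ) ∣ D.c))
    (hRa : ∀ (W : WeierstrassCurve ℚ) [W.IsElliptic] [W.IsGloballyMinimal] {N : ℕ} [NeZero N]
      (D : ModularParametrizationData W N),
      (∀ z ∈ D.L.lattice, ∃ w ∈ periodLattice D.f, z = D.c * w) → 2 ^ 2 ∣ N →
      P W N → W.HasIrreducibleModPGaloisRep 2 → 0 < W.Δ → ¬ (4 : ℤ) ∣ D.c → ¬ (2 : ℤ) ∣ D.c)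
    (hRb : ∀ (W : WeierstrassCurve ℚ) [W.IsElliptic] [W.IsGloballyMinimal] {N : ℕ} [NeZero N]
      (D : ModularParametrizationData W N),
      (∀ z ∈ D.L.lattice, ∃ w ∈ periodLattice D.f, z = D.c * w) → 2 ^ 2 ∣ N →
      P W N → ¬ W.HasIrreducibleModPGaloisRep 2 → ¬ (2 : ℤ) ∣ D.c)
    : Summit.BirchSwinnertonDyer.BirchSwinnertonDyer.Theses.ManinLocalTwoThree.ManinOddAtFour :=
  hred (fun _hM _hAU _hC _hnf W _ _ N _ D hopt h4 hP => by
    show ¬ (2 : ℤ) ∣ D.c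
    by_cases hirr : W.HasIrreducibleModPGaloisRep 2
    · obtain ⟨h4c, hneg⟩ := hA W D hopt h4 hP hirr
      rcases lt_trichotomy W.Δ 0 with hlt | heq | hgt
      · exact hneg hlt
      · exact absurd heq W.isUnit_Δ.ne_zero
      · exact hRa W D hopt h4 hP hirr hgt h4c
    · exact hRb W D hopt h4 hP hirr)

/-- **Generic split, certificate := E-es-21 `KatoShiftTwistManinTwo`** (the leaf, unrestricted).
[cite: Kato2004Asterisque, Thm. 9.7 (p. 189)] -/
theorem maninOddAtFour_of_reduction_of_katoShift
    (hred : (Literature.NumberTheory.EllipticCurves.ModularForms.mazur_not_dvd_maninConstant_of_odd →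
      Literature.NumberTheory.EllipticCurves.ModularForms.abbesUllmo_not_dvd_maninConstant_of_not_dvd_level →
      Literature.NumberTheory.EllipticCurves.ModularForms.cesnavicius_not_two_dvd_maninConstant_of_two_dvd_level →
      Literature.NumberTheory.EllipticCurves.ModularForms.exists_isNewformOf →
      ∀ (W : WeierstrassCurve ℚ) [W.IsElliptic] [W.IsGloballyMinimal] {N : ℕ} [NeZero N]
        (D : ModularParametrizationData W N),
        (∀ z ∈ D.L.lattice, ∃ w ∈ periodLattice D.f, z = D.c * w) → 2 ^ 2 ∣ N → P W N →
        ¬ (2 : ℤ) ∣ D.maninConstant) →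
      Summit.BirchSwinnertonDyer.BirchSwinnertonDyer.Theses.ManinLocalTwoThree.ManinOddAtFour)
    (hK2 : KatoShiftTwistManinTwo)
    (hRa : ∀ (W : WeierstrassCurve ℚ) [W.IsElliptic] [W.IsGloballyMinimal] {N : ℕ} [NeZero N]
      (D : ModularParametrizationData W N),
      (∀ z ∈ D.L.lattice, ∃ w ∈ periodLattice D.f, z = D.c * w) → 2 ^ 2 ∣ N →
      P W N → W.HasIrreducibleModPGaloisRep 2 → 0 < W.Δ → ¬ (4 : ℤ) ∣ D.c → ¬ (2 : ℤ) ∣ D.c)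
    (hRb : ∀ (W : WeierstrassCurve ℚ) [W.IsElliptic] [W.IsGloballyMinimal] {N : ℕ} [NeZero N]
      (D : ModularParametrizationData W N),
      (∀ z ∈ D.L.lattice, ∃ w ∈ periodLattice D.f, z = D.c * w) → 2 ^ 2 ∣ N →
      P W N → ¬ W.HasIrreducibleModPGaloisRep 2 → ¬ (2 : ℤ) ∣ D.c)
    : Summit.BirchSwinnertonDyer.BirchSwinnertonDyer.Theses.ManinLocalTwoThree.ManinOddAtFour :=
  maninOddAtFour_of_reduction_of_split P hred (fun W _ _ _ _ D hopt h4 _ hirr => hK2 W D hopt h4 hirr) hRa hRb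

/-- **Generic split, certificate := F-es-21 ∧ E-es-22** (through the landed lever
`katoShiftTwistManinTwo_of_katoFact_of_generation`). [cite: Kato2004Asterisque, Thm. 9.7 (p. 189)] -/
theorem maninOddAtFour_of_reduction_of_katoFact_of_generation
    (hred : (Literature.NumberTheory.EllipticCurves.ModularForms.mazur_not_dvd_maninConstant_of_odd →
      Literature.NumberTheory.EllipticCurves.ModularForms.abbesUllmo_not_dvd_maninConstant_of_not_dvd_level →
      Literature.NumberTheory.EllipticCurves.ModularForms.cesnavicius_not_two_dvd_maninConstant_of_two_dvd_level →
      Literature.NumberTheory.EllipticCurves.ModularForms.exists_isNewformOf →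
      ∀ (W : WeierstrassCurve ℚ) [W.IsElliptic] [W.IsGloballyMinimal] {N : ℕ} [NeZero N]
        (D : ModularParametrizationData W N),
        (∀ z ∈ D.L.lattice, ∃ w ∈ periodLattice D.f, z = D.c * w) → 2 ^ 2 ∣ N → P W N →
        ¬ (2 : ℤ) ∣ D.maninConstant) →
      Summit.BirchSwinnertonDyer.BirchSwinnertonDyer.Theses.ManinLocalTwoThree.ManinOddAtFour)
    (hK : kato_neron_isIntegral_twistedSymbolSum_of_additive_two_polar) (hG : MultiShiftClassGenerationTwo)
    (hRa : ∀ (W : WeierstrassCurve ℚ) [W.IsElliptic] [W.IsGloballyMinimal] {N : ℕ} [NeZero N]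
      (D : ModularParametrizationData W N),
      (∀ z ∈ D.L.lattice, ∃ w ∈ periodLattice D.f, z = D.c * w) → 2 ^ 2 ∣ N →
      P W N → W.HasIrreducibleModPGaloisRep 2 → 0 < W.Δ → ¬ (4 : ℤ) ∣ D.c → ¬ (2 : ℤ) ∣ D.c)
    (hRb : ∀ (W : WeierstrassCurve ℚ) [W.IsElliptic] [W.IsGloballyMinimal] {N : ℕ} [NeZero N]
      (D : ModularParametrizationData W N),
      (∀ z ∈ D.L.lattice, ∃ w ∈ periodLattice D.f, z = D.c * w) → 2 ^ 2 ∣ N →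
      P W N → ¬ W.HasIrreducibleModPGaloisRep 2 → ¬ (2 : ℤ) ∣ D.c)
    : Summit.BirchSwinnertonDyer.BirchSwinnertonDyer.Theses.ManinLocalTwoThree.ManinOddAtFour :=
  maninOddAtFour_of_reduction_of_katoShift P hred (katoShiftTwistManinTwo_of_katoFact_of_generation hK hG) hRa hRb

end Generic

section Orbit

/-- **C2 ⟸ the `p = 2` Kato fact F-es-21 ∧ the multi-shift generation law E-es-22 ∧ (both residuals on the
TWIST-ORBIT-MINIMAL classes)** — line `kato-shift-two` end to end with the smallest residuals the landed reductions allow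
(259 325 orbit-minimal classes with `4 ∣ N < 5·10⁵`, of which the `W[2]`-irreducible `Δ_W < 0` ones are decided).
A `proof.conditional`. [cite: Kato2004Asterisque, Thm. 9.7 (p. 189)] [cite: Stevens1989, Lemmas (5.2), (5.4)] -/
theorem maninOddAtFour_of_katoFact_of_generation_of_orbitMinimalResiduals
    (hK : kato_neron_isIntegral_twistedSymbolSum_of_additive_two_polar) (hG : MultiShiftClassGenerationTwo)
    (hRa : ∀ (W : WeierstrassCurve ℚ) [W.IsElliptic] [W.IsGloballyMinimal] {N : ℕ} [NeZero N]
      (D : ModularParametrizationData W N),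
      (∀ z ∈ D.L.lattice, ∃ w ∈ periodLattice D.f, z = D.c * w) → 2 ^ 2 ∣ N →
      ¬ (∃ (W' : WeierstrassCurve ℚ) (d : ℤ), W'.IsElliptic ∧ W'.IsGloballyMinimal ∧
        (d = -1 ∨ d = 2 ∨ d = -2) ∧ IsIsogenous W (W'.quadraticTwist (d : ℚ)) ∧
        ¬ 2 ^ 2 ∣ W'.conductorNorm ℤ) →
      ¬ (∃ (W' : WeierstrassCurve ℚ) (q : ℕ), W'.IsElliptic ∧ W'.IsGloballyMinimal ∧
        q.Prime ∧ q ≠ 2 ∧ q ^ 2 ∣ N ∧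
        IsIsogenous W (W'.quadraticTwist (((-1 : ℤ) ^ (q / 2) * q : ℤ) : ℚ)) ∧
        ¬ q ^ 2 ∣ W'.conductorNorm ℤ) →
      ¬ (∃ (A : WeierstrassCurve ℚ), A.IsElliptic ∧ A.IsGloballyMinimal ∧ 2 ^ 4 ∣ N ∧
        2 ^ 2 ∣ A.conductorNorm ℤ ∧ A.conductorNorm ℤ ∣ N ∧ A.conductorNorm ℤ < N ∧
        IsIsogenous W (A.quadraticTwist ((-1 : ℤ) : ℚ))) →
      ¬ (∃ (A : WeierstrassCurve ℚ) (_ : A.IsElliptic) (_ : A.IsGloballyMinimal) (N' : ℕ) (_ : NeZero N')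
        (D' : ModularParametrizationData A N') (d : ℤ) (C : WeierstrassCurve ℚ) (u : VariableChange ℚ),
        C.IsElliptic ∧ C.IsGloballyMinimal ∧
        (∀ z ∈ D'.L.lattice, ∃ w ∈ periodLattice D'.f, z = D'.c * w) ∧ (d = 2 ∨ d = -2) ∧ 2 ^ 6 ∣ N ∧
        2 ^ 2 ∣ A.conductorNorm ℤ ∧ A.conductorNorm ℤ ∣ N ∧
        IsIsogenous W (A.quadraticTwist (d : ℚ)) ∧ u • A.quadraticTwist (d : ℚ) = C ∧
        C.Δ = (d : ℚ) ^ 6 * A.Δ ∧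
        (A.conductorNorm ℤ < N ∨ A.minimalDiscriminantInt.natAbs < W.minimalDiscriminantInt.natAbs)) →
      ¬ (∃ (A : WeierstrassCurve ℚ) (_ : A.IsElliptic) (_ : A.IsGloballyMinimal)
        (D' : ModularParametrizationData A N) (q : ℕ) (C : WeierstrassCurve ℚ) (u : VariableChange ℚ),
        C.IsElliptic ∧ C.IsGloballyMinimal ∧
        (∀ z ∈ D'.L.lattice, ∃ w ∈ periodLattice D'.f, z = D'.c * w) ∧ q.Prime ∧ q ≠ 2 ∧ q ^ 2 ∣ N ∧
        IsIsogenous C W ∧ u • A.quadraticTwist (((-1 : ℤ) ^ (q / 2) * q : ℤ) : ℚ) = C ∧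
        C.Δ = ((((-1 : ℤ) ^ (q / 2) * q : ℤ)) : ℚ) ^ 6 * A.Δ ∧
        A.minimalDiscriminantInt.natAbs < W.minimalDiscriminantInt.natAbs) →
      W.HasIrreducibleModPGaloisRep 2 → 0 < W.Δ → ¬ (4 : ℤ) ∣ D.c → ¬ (2 : ℤ) ∣ D.c)
    (hRb : ∀ (W : WeierstrassCurve ℚ) [W.IsElliptic] [W.IsGloballyMinimal] {N : ℕ} [NeZero N]
      (D : ModularParametrizationData W N),
      (∀ z ∈ D.L.lattice, ∃ w ∈ periodLattice D.f, z = D.c * w) → 2 ^ 2 ∣ N →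
      ¬ (∃ (W' : WeierstrassCurve ℚ) (d : ℤ), W'.IsElliptic ∧ W'.IsGloballyMinimal ∧
        (d = -1 ∨ d = 2 ∨ d = -2) ∧ IsIsogenous W (W'.quadraticTwist (d : ℚ)) ∧
        ¬ 2 ^ 2 ∣ W'.conductorNorm ℤ) →
      ¬ (∃ (W' : WeierstrassCurve ℚ) (q : ℕ), W'.IsElliptic ∧ W'.IsGloballyMinimal ∧
        q.Prime ∧ q ≠ 2 ∧ q ^ 2 ∣ N ∧
        IsIsogenous W (W'.quadraticTwist (((-1 : ℤ) ^ (q / 2) * q : ℤ) : ℚ)) ∧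
        ¬ q ^ 2 ∣ W'.conductorNorm ℤ) →
      ¬ (∃ (A : WeierstrassCurve ℚ), A.IsElliptic ∧ A.IsGloballyMinimal ∧ 2 ^ 4 ∣ N ∧
        2 ^ 2 ∣ A.conductorNorm ℤ ∧ A.conductorNorm ℤ ∣ N ∧ A.conductorNorm ℤ < N ∧
        IsIsogenous W (A.quadraticTwist ((-1 : ℤ) : ℚ))) →
      ¬ (∃ (A : WeierstrassCurve ℚ) (_ : A.IsElliptic) (_ : A.IsGloballyMinimal) (N' : ℕ) (_ : NeZero N')
        (D' : ModularParametrizationData A N') (d : ℤ) (C : WeierstrassCurve ℚ) (u : VariableChange ℚ),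
        C.IsElliptic ∧ C.IsGloballyMinimal ∧
        (∀ z ∈ D'.L.lattice, ∃ w ∈ periodLattice D'.f, z = D'.c * w) ∧ (d = 2 ∨ d = -2) ∧ 2 ^ 6 ∣ N ∧
        2 ^ 2 ∣ A.conductorNorm ℤ ∧ A.conductorNorm ℤ ∣ N ∧
        IsIsogenous W (A.quadraticTwist (d : ℚ)) ∧ u • A.quadraticTwist (d : ℚ) = C ∧
        C.Δ = (d : ℚ) ^ 6 * A.Δ ∧
        (A.conductorNorm ℤ < N ∨ A.minimalDiscriminantInt.natAbs < W.minimalDiscriminantInt.natAbs)) →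
      ¬ (∃ (A : WeierstrassCurve ℚ) (_ : A.IsElliptic) (_ : A.IsGloballyMinimal)
        (D' : ModularParametrizationData A N) (q : ℕ) (C : WeierstrassCurve ℚ) (u : VariableChange ℚ),
        C.IsElliptic ∧ C.IsGloballyMinimal ∧
        (∀ z ∈ D'.L.lattice, ∃ w ∈ periodLattice D'.f, z = D'.c * w) ∧ q.Prime ∧ q ≠ 2 ∧ q ^ 2 ∣ N ∧
        IsIsogenous C W ∧ u • A.quadraticTwist (((-1 : ℤ) ^ (q / 2) * q : ℤ) : ℚ) = C ∧
        C.Δ = ((((-1 : ℤ) ^ (q / 2) * q : ℤ)) : ℚ) ^ 6 * A.Δ ∧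
        A.minimalDiscriminantInt.natAbs < W.minimalDiscriminantInt.natAbs) →
      ¬ W.HasIrreducibleModPGaloisRep 2 → ¬ (2 : ℤ) ∣ D.c)
    : Summit.BirchSwinnertonDyer.BirchSwinnertonDyer.Theses.ManinLocalTwoThree.ManinOddAtFour :=
  maninLocalTwoThree_maninOddAtFour_of_katoShift_of_orbitMinimalResiduals
    (katoShiftTwistManinTwo_of_katoFact_of_generation hK hG) hRa hRb

end Orbit

section Partition

variable (P : WeierstrassCurve ℚ → ℕ → Prop)

/-- **The generic split is LOSSLESS**: granted the route's printed-fact bundle `PrintedSemistableManinFacts` (the crux's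
four leading binders) and any reduction `hred` to a class predicate `P`, C2 is EQUIVALENT to the conjunction
(multi-shift certificate on the `W[2]`-irreducible data with `P`) ∧ (archimedean residual on the irreducible data with
`P`) ∧ (Manin at `2` on the `W[2]`-reducible data with `P`) — each conjunct being a restriction of the crux
(`4 ∣ c ⟹ 2 ∣ c`). [cite: Stevens1989, Lemmas (5.2), (5.4)] [cite: Kato2004Asterisque, Thm. 9.7 (p. 189)] -/
theorem maninOddAtFour_iff_split_of_reduction (hPF : Summit.BirchSwinnertonDyer.BirchSwinnertonDyer.Theses.ManinLocalTwoThree.PrintedSemistableManinFacts)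
    (hred : (Literature.NumberTheory.EllipticCurves.ModularForms.mazur_not_dvd_maninConstant_of_odd →
      Literature.NumberTheory.EllipticCurves.ModularForms.abbesUllmo_not_dvd_maninConstant_of_not_dvd_level →
      Literature.NumberTheory.EllipticCurves.ModularForms.cesnavicius_not_two_dvd_maninConstant_of_two_dvd_level →
      Literature.NumberTheory.EllipticCurves.ModularForms.exists_isNewformOf →
      ∀ (W : WeierstrassCurve ℚ) [W.IsElliptic] [W.IsGloballyMinimal] {N : ℕ} [NeZero N]
        (D : ModularParametrizationData W N),
        (∀ z ∈ D.L.lattice, ∃ w ∈ periodLattice D.f, z = D.c * w) → 2 ^ 2 ∣ N → P W N →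
        ¬ (2 : ℤ) ∣ D.maninConstant) →
      Summit.BirchSwinnertonDyer.BirchSwinnertonDyer.Theses.ManinLocalTwoThree.ManinOddAtFour) :
    Summit.BirchSwinnertonDyer.BirchSwinnertonDyer.Theses.ManinLocalTwoThree.ManinOddAtFour ↔
      ((∀ (W : WeierstrassCurve ℚ) [W.IsElliptic] [W.IsGloballyMinimal] {N : ℕ} [NeZero N]
        (D : ModularParametrizationData W N),
        (∀ z ∈ D.L.lattice, ∃ w ∈ periodLattice D.f, z = D.c * w) → 2 ^ 2 ∣ N → P W N →
          W.HasIrreducibleModPGaloisRep 2 → ¬ (4 : ℤ) ∣ D.c ∧ (W.Δ < 0 → ¬ (2 : ℤ) ∣ D.c)) ∧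
        (∀ (W : WeierstrassCurve ℚ) [W.IsElliptic] [W.IsGloballyMinimal] {N : ℕ} [NeZero N]
        (D : ModularParametrizationData W N),
        (∀ z ∈ D.L.lattice, ∃ w ∈ periodLattice D.f, z = D.c * w) → 2 ^ 2 ∣ N → P W N →
          W.HasIrreducibleModPGaloisRep 2 → 0 < W.Δ → ¬ (4 : ℤ) ∣ D.c → ¬ (2 : ℤ) ∣ D.c) ∧
        (∀ (W : WeierstrassCurve ℚ) [W.IsElliptic] [W.IsGloballyMinimal] {N : ℕ} [NeZero N]
        (D : ModularParametrizationData W N),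
        (∀ z ∈ D.L.lattice, ∃ w ∈ periodLattice D.f, z = D.c * w) → 2 ^ 2 ∣ N → P W N →
          ¬ W.HasIrreducibleModPGaloisRep 2 → ¬ (2 : ℤ) ∣ D.c)) := by
  obtain ⟨hM, hAU, hC, hnf⟩ := hPF
  refine ⟨fun h2 => ⟨?_, ?_, ?_⟩, fun h => maninOddAtFour_of_reduction_of_split P hred h.1 h.2.1 h.2.2⟩
  · intro W _ _ N _ D hopt h4 _ _
    have h : ¬ (2 : ℤ) ∣ D.c := h2 hM hAU hC hnf W D hopt h4
    exact ⟨fun h4c => h (dvd_trans ⟨2, by norm_num⟩ h4c), fun _ => h⟩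
  · intro W _ _ N _ D hopt h4 _ _ _ _
    exact h2 hM hAU hC hnf W D hopt h4
  · intro W _ _ N _ D hopt h4 _ _
    exact h2 hM hAU hC hnf W D hopt h4

end Partition

end Summit.BirchSwinnertonDyer.BirchSwinnertonDyer.Theorems.ManinLocalTwoThree

end
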